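import Mathlib
import HarnessLib
import Summits.Ventures.LatticeQCDFlow.Exactness.NCMCGeneralSpaceOccupancyChainErrorBars

/-!
# The CLT variance of the occupancy IS the limit of `n · Var p̂_n`: `τ_N(ρ_A) → τ_int(ρ_A)` under a Doeblin power, and `n · Var_{π_c} p̂_n → 2 τ_int(ρ_occ) σ(1 − σ)` for the NCMC lane

HONEST FRAMING: exact (Metropolis-corrected) sampling algorithms for lattice gauge theory;
figures of merit are autocorrelation/cost numbers at stated couplings and volumes; no
continuum-physics claim.

Venture `LatticeQCDFlow` (cell pub-lqcd), topic `Exactness`; FANOUT row 13 (`eng-snf`, GEN-19).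
NEW WORK of the cell, not a published result; no definition is introduced; nothing is cited as a
fact.  A CONSISTENCY CHECK between the two typed error statements for the NCMC occupancy: GEN-17's
EXACT finite-`n` identity `Var_{π_c} p̂_n = 2 τ_n(ρ_occ) σ(1 − σ)/n` (row 11's finite-window time
`Scoring.tauIntN`) and GEN-19's CLT variance `2 τ_int(ρ_occ) σ(1 − σ)` (`Scoring.tauInt`,
`NCMCGeneralSpaceOccupancyChainCLT`).  The link is row 11's `Scoring.tendsto_tauIntN` (`τ_N → τ_int`
once `Σ (t+1)|ρ_{t+1}| < ∞`), whose moment hypothesis is discharged here under an `m`-step Doeblin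
minorisation by the block comparison `Σ_{t < mQ} (t+1) x^{⌊t/m⌋} ≤ m² Σ_{q<Q} (q+1) x^q`
(row 8 proved the one-step case, `Scoring.tendsto_tauIntN_of_doeblin`).

## Content

* `sum_range_succ_mul_pow_div_le`, `summable_succ_mul_pow_div` — `t ↦ (t+1) x^{⌊t/m⌋}` is summable
  (`0 ≤ x < 1`, `m ≥ 1`).
* **`summable_moment_setACF_of_nHit`**, **`tendsto_tauIntN_setACF_of_nHit`** — for a chain with a
  Doeblin power and an event `A` with `0 < π(A) < 1`: `Σ (t+1)|ρ_A(t+1)| < ∞` and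
  `Scoring.tauIntN (setACF κ π A) N → Scoring.tauInt (setACF κ π A)`.
* **`CrooksPair.ncmc_tendsto_mul_variance_occupancy_of_sq`** — for the NCMC lane under GEN-18's
  two-step certificate: `n · Var_{π_c}[p̂_n] → 2 τ_int(ρ_occ) σ(1 − σ)`, the variance of the Gaussian
  limit in `CrooksPair.ncmc_occupancy_clt_of_sq`.

NOT CLAIMED: uniform integrability / convergence of moments of `√n (p̂_n − σ)` beyond the second
(not needed); anything numerical.
-/

namespace Summit.Ventures.LatticeQCDFlow.Exactness.GeneralNCMC

open MeasureTheory ProbabilityTheory Set Filter Finset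
open scoped ENNReal Topology

/-! ## §1 The comparison series `Σ (t+1) x^{⌊t/m⌋}` -/

section Series

variable {x : ℝ} {m : ℕ}

/-- Block bound: `Σ_{t < mQ} (t+1) x^{⌊t/m⌋} ≤ m² Σ_{q<Q} (q+1) x^q` (`0 ≤ x`, `m ≥ 1`). -/
theorem sum_range_succ_mul_pow_div_le (hm : 0 < m) (hx0 : 0 ≤ x) : ∀ Q : ℕ,
    ∑ t ∈ range (m * Q), ((t : ℝ) + 1) * x ^ (t / m)
      ≤ (m : ℝ) ^ 2 * ∑ q ∈ range Q, ((q : ℝ) + 1) * x ^ q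
  | 0 => by simp
  | Q + 1 => by
    rw [Nat.mul_succ, Finset.sum_range_add, Finset.sum_range_succ, mul_add]
    refine add_le_add (sum_range_succ_mul_pow_div_le hm hx0 Q) ?_
    have h : ∀ s ∈ range m, ((((m * Q + s : ℕ) : ℝ)) + 1) * x ^ ((m * Q + s) / m)
        ≤ (m : ℝ) * (((Q : ℝ) + 1) * x ^ Q) := by
      intro s hs
      have hs' := Finset.mem_range.1 hs
      rw [Nat.mul_add_div hm, Nat.div_eq_of_lt hs', Nat.add_zero]
      have h1 : ((m * Q + s : ℕ) : ℝ) + 1 ≤ (m : ℝ) * ((Q : ℝ) + 1) := by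
        have : (m * Q + s : ℕ) + 1 ≤ m * (Q + 1) := by nlinarith
        exact_mod_cast this
      calc ((((m * Q + s : ℕ) : ℝ)) + 1) * x ^ Q ≤ (m : ℝ) * ((Q : ℝ) + 1) * x ^ Q :=
            mul_le_mul_of_nonneg_right h1 (pow_nonneg hx0 Q)
        _ = (m : ℝ) * (((Q : ℝ) + 1) * x ^ Q) := by ring
    calc ∑ s ∈ range m, ((((m * Q + s : ℕ) : ℝ)) + 1) * x ^ ((m * Q + s) / m)
        ≤ ∑ _s ∈ range m, (m : ℝ) * (((Q : ℝ) + 1) * x ^ Q) := Finset.sum_le_sum h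
      _ = (m : ℝ) ^ 2 * (((Q : ℝ) + 1) * x ^ Q) := by
          rw [Finset.sum_const, Finset.card_range, nsmul_eq_mul]; ring

/-- `t ↦ (t+1) x^{⌊t/m⌋}` is summable for `0 ≤ x < 1`, `m ≥ 1`. -/
theorem summable_succ_mul_pow_div (hm : 0 < m) (hx0 : 0 ≤ x) (hx1 : x < 1) :
    Summable fun t : ℕ => ((t : ℝ) + 1) * x ^ (t / m) := by
  have hgeo : Summable fun q : ℕ => ((q : ℝ) + 1) * x ^ q := by
    have h1 : Summable fun q : ℕ => (q : ℝ) ^ 1 * x ^ q :=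
      summable_pow_mul_geometric_of_norm_lt_one 1 (by rw [Real.norm_eq_abs, abs_of_nonneg hx0]; exact hx1)
    have h2 : Summable fun q : ℕ => x ^ q := summable_geometric_of_lt_one hx0 hx1
    simpa [pow_one, add_mul] using h1.add h2
  refine summable_of_sum_range_le (c := (m : ℝ) ^ 2 * ∑' q : ℕ, ((q : ℝ) + 1) * x ^ q)
    (fun t => by positivity) fun n => ?_
  have hsub : range n ⊆ range (m * n) := Finset.range_subset_range.2 (Nat.le_mul_of_pos_left n hm)
  calc ∑ t ∈ range n, ((t : ℝ) + 1) * x ^ (t / m)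
      ≤ ∑ t ∈ range (m * n), ((t : ℝ) + 1) * x ^ (t / m) :=
        Finset.sum_le_sum_of_subset_of_nonneg hsub fun t _ _ => by positivity
    _ ≤ (m : ℝ) ^ 2 * ∑ q ∈ range n, ((q : ℝ) + 1) * x ^ q := sum_range_succ_mul_pow_div_le hm hx0 n
    _ ≤ (m : ℝ) ^ 2 * ∑' q : ℕ, ((q : ℝ) + 1) * x ^ q :=
        mul_le_mul_of_nonneg_left
          (sum_le_hasSum _ (fun q _ => by positivity) hgeo.hasSum) (by positivity)

end Series

/-! ## §2 `τ_N → τ_int` for an event under a Doeblin power -/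

section Event

variable {S : Type*} [MeasurableSpace S]
  {κ : Kernel S S} [IsMarkovKernel κ] {π : Measure S} [IsProbabilityMeasure π]
  {ν : Measure S} [IsProbabilityMeasure ν] {ε : ℝ≥0∞} {m : ℕ}

/-- The moment series `Σ (t+1) |ρ_A(t+1)|` converges under a Doeblin power (`0 < π(A) < 1`). -/
theorem summable_moment_setACF_of_nHit
    (hmin : ∀ x {B : Set S}, MeasurableSet B → ε * ν B ≤ nHit κ m x B) (hε0 : 0 < ε) (hε1 : ε ≤ 1)
    (hm : 0 < m) (hπ : Kernel.Invariant κ π) {A : Set S} (hA : MeasurableSet A)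
    (h0 : 0 < π.real A) (h1 : π.real A < 1) :
    Summable fun t : ℕ => ((t : ℝ) + 1) * |setACF κ π A (t + 1)| := by
  have hεtop : ε ≠ ∞ := ne_top_of_le_ne_top ENNReal.one_ne_top hε1
  have hr0 : 0 ≤ 1 - ε.toReal :=
    sub_nonneg.2 (ENNReal.toReal_le_of_le_ofReal zero_le_one (by simpa using hε1))
  have hr1' : 1 - ε.toReal ≤ 1 := sub_le_self _ ENNReal.toReal_nonneg
  have hr1 : 1 - ε.toReal < 1 := sub_lt_self _ (ENNReal.toReal_pos hε0.ne' hεtop)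
  have hq : 0 < 1 - π.real A := sub_pos.2 h1
  refine Summable.of_nonneg_of_le (fun t => by positivity) (fun t => ?_)
    ((summable_succ_mul_pow_div hm hr0 hr1).mul_left ((1 - π.real A)⁻¹))
  have henv := abs_setACF_le_of_nHit hmin hε1 hπ hA h0 h1 (t + 1)
  have hmono : (1 - ε.toReal) ^ ((t + 1) / m) ≤ (1 - ε.toReal) ^ (t / m) :=
    pow_le_pow_of_le_one hr0 hr1' (Nat.div_le_div_right (Nat.le_succ t))
  calc ((t : ℝ) + 1) * |setACF κ π A (t + 1)|
      ≤ ((t : ℝ) + 1) * ((1 - ε.toReal) ^ (t / m) / (1 - π.real A)) :=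
        mul_le_mul_of_nonneg_left (henv.trans (div_le_div_of_nonneg_right hmono hq.le))
          (by positivity)
    _ = (1 - π.real A)⁻¹ * (((t : ℝ) + 1) * (1 - ε.toReal) ^ (t / m)) := by
        rw [div_eq_mul_inv]; ring

/-- **`τ_N(ρ_A) → τ_int(ρ_A)`** under a Doeblin power: row 11's finite-window integrated
autocorrelation time of the event indicator converges to the scorers' `Scoring.tauInt`. -/
theorem tendsto_tauIntN_setACF_of_nHit
    (hmin : ∀ x {B : Set S}, MeasurableSet B → ε * ν B ≤ nHit κ m x B) (hε0 : 0 < ε) (hε1 : ε ≤ 1)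
    (hm : 0 < m) (hπ : Kernel.Invariant κ π) {A : Set S} (hA : MeasurableSet A)
    (h0 : 0 < π.real A) (h1 : π.real A < 1) :
    Tendsto (fun N => Scoring.tauIntN (setACF κ π A) N) atTop
      (𝓝 (Scoring.tauInt (setACF κ π A))) :=
  Scoring.tendsto_tauIntN (summable_moment_setACF_of_nHit hmin hε0 hε1 hm hπ hA h0 h1)

end Event

/-! ## §3 The NCMC occupancy: `n · Var p̂_n → 2 τ_int σ(1 − σ)` -/

section NCMC

variable {Ω E : Type*} [MeasurableSpace Ω] [MeasurableSpace E]
  {ν₀ ν₁ : Measure Ω} [IsFiniteMeasure ν₀] [IsFiniteMeasure ν₁]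
  {κF κR : Kernel Ω E} [IsMarkovKernel κF] [IsMarkovKernel κR] {s e : E → Ω} {W : E → ℝ} {c : ℝ}
  {T₀ T₁ : Kernel Ω Ω} [IsMarkovKernel T₀] [IsMarkovKernel T₁] {ε : ℝ≥0∞}
  {ν : Measure (Bool × Ω)} [IsProbabilityMeasure ν]

/-- **THE CLT VARIANCE IS THE LIMIT OF `n · Var p̂_n`.**  Under a two-step minorisation
`ε • ν ≤ (nHit Q 2)(z, ·)` (`ε ≠ 0`), along the NCMC chain in equilibrium (`π_c`):
`n · Var[p̂_n] → 2 τ_int(ρ_occ) σ(1 − σ)`, `σ = σ(c − ΔF)`, `ρ_occ = setACF Q π_c (target level)` —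
GEN-17's exact `Var p̂_n = 2τ_n σ(1 − σ)/n` with `τ_n → τ_int`. -/
theorem CrooksPair.ncmc_tendsto_mul_variance_occupancy_of_sq (h : CrooksPair ν₀ ν₁ κF κR s e W)
    (h0 : ν₀ univ ≠ 0) (h1 : ν₁ univ ≠ 0) (hT₀ : Kernel.Invariant T₀ ν₀)
    (hT₁ : Kernel.Invariant T₁ ν₁) (hε : ε ≠ 0)
    (hD : haveI := isMarkovKernel_switchKernel (κF := κF) (κR := κR) (c := c)
              h.measurable_W h.measurable_s h.measurable_e
      ∀ z, ε • ν ≤ nHit (switchKernel κF κR c W s e ∘ₖ levelKernel T₀ T₁) 2 z)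
    {ΔF : ℝ} (hΔF : Real.exp (-ΔF) = ((ν₀ univ)⁻¹ * ν₁ univ).toReal) :
    haveI := isMarkovKernel_switchKernel (κF := κF) (κR := κR) (c := c)
      h.measurable_W h.measurable_s h.measurable_e
    haveI := isMarkovKernel_levelKernel T₀ T₁
    Tendsto (fun n : ℕ => (n : ℝ) *
      Var[fun z : ℕ → Bool × Ω => (∑ i ∈ range n, (targetLevel Ω).indicator (1 : Bool × Ω → ℝ) (z i)) / n;
        Kernel.trajMeasure (X := fun _ : ℕ => Bool × Ω)
          ((jointWeight c ν₀ ν₁ univ)⁻¹ • jointWeight c ν₀ ν₁)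
          (fun n : ℕ => (switchKernel κF κR c W s e ∘ₖ levelKernel T₀ T₁).comap
            (fun hh : (j : ↥(Finset.Iic n)) → Bool × Ω => hh ⟨n, Finset.mem_Iic.2 le_rfl⟩)
            (measurable_pi_apply _))]) atTop
      (𝓝 (2 * Scoring.tauInt (setACF (switchKernel κF κR c W s e ∘ₖ levelKernel T₀ T₁)
          ((jointWeight c ν₀ ν₁ univ)⁻¹ • jointWeight c ν₀ ν₁) (targetLevel Ω))
        * (Real.sigmoid (c - ΔF) * (1 - Real.sigmoid (c - ΔF))))) := by
  haveI := isMarkovKernel_switchKernel (κF := κF) (κR := κR) (c := c)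
    h.measurable_W h.measurable_s h.measurable_e
  haveI := isMarkovKernel_levelKernel T₀ T₁
  haveI := isProbabilityMeasure_jointLaw c ν₀ ν₁ h0
  obtain ⟨x0, -⟩ := nonempty_of_measure_ne_zero h0
  haveI : Nonempty (Bool × Ω) := ⟨(false, x0)⟩
  haveI := isMarkovKernel_nHit (switchKernel κF κR c W s e ∘ₖ levelKernel T₀ T₁) 2
  have hinv : Kernel.Invariant (switchKernel κF κR c W s e ∘ₖ levelKernel T₀ T₁)
      ((jointWeight c ν₀ ν₁ univ)⁻¹ • jointWeight c ν₀ ν₁) :=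
    invariant_smul _ (iteration_invariant h hT₀ hT₁ c) _
  have hσ := jointLaw_real_targetLevel c ν₀ ν₁ h0 h1 hΔF
  have hσ0 : 0 < Real.sigmoid (c - ΔF) := Real.sigmoid_pos _
  have hσ1 : Real.sigmoid (c - ΔF) < 1 := Real.sigmoid_lt_one _
  -- the autocorrelation in GEN-17's identity is `setACF Q π_c (target level)`
  have hρ : (fun t => cov[fun z : ℕ → Bool × Ω => (targetLevel Ω).indicator (1 : Bool × Ω → ℝ) (z 0),
      fun z : ℕ → Bool × Ω => (targetLevel Ω).indicator (1 : Bool × Ω → ℝ) (z t);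
      Kernel.trajMeasure (X := fun _ : ℕ => Bool × Ω)
        ((jointWeight c ν₀ ν₁ univ)⁻¹ • jointWeight c ν₀ ν₁)
        (fun n : ℕ => (switchKernel κF κR c W s e ∘ₖ levelKernel T₀ T₁).comap
          (fun hh : (j : ↥(Finset.Iic n)) → Bool × Ω =>
          hh ⟨n, Finset.mem_Iic.2 le_rfl⟩) (measurable_pi_apply _))] /
      (Real.sigmoid (c - ΔF) * (1 - Real.sigmoid (c - ΔF)))) =
      setACF (switchKernel κF κR c W s e ∘ₖ levelKernel T₀ T₁)
        ((jointWeight c ν₀ ν₁ univ)⁻¹ • jointWeight c ν₀ ν₁) (targetLevel Ω) := by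
    funext t
    rw [setACF, chain_cov_indicator_eq_setAutocov _ hinv measurableSet_targetLevel t,
      setAutocov_zero measurableSet_targetLevel, hσ]
  -- `τ_N → τ_int`
  have hτ := tendsto_tauIntN_setACF_of_nHit (fun x B hB => minorised_setwise hD x hB)
    (pos_iff_ne_zero.2 hε) (eps_le_one_of_minorised hD) two_pos hinv measurableSet_targetLevel
    (by rw [hσ]; exact hσ0) (by rw [hσ]; exact hσ1)
  have hlim := (hτ.const_mul 2).mul_const (Real.sigmoid (c - ΔF) * (1 - Real.sigmoid (c - ΔF)))
  refine hlim.congr' ?_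
  filter_upwards [eventually_ne_atTop 0] with n hn
  have hnR : (n : ℝ) ≠ 0 := by exact_mod_cast hn
  rw [variance_occupancy_chain (switchKernel κF κR c W s e ∘ₖ levelKernel T₀ T₁) h0 h1
    (iteration_invariant h hT₀ hT₁ c) hΔF hn, hρ]
  field_simp

end NCMC

end Summit.Ventures.LatticeQCDFlow.Exactness.GeneralNCMC
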